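import Literature.MathematicalPhysics.QuantumFieldTheory.QuasiLocalGaugePerturbationDecoupling
import HarnessLib

/-!
# Quasi-local gauge-invariant perturbations, VII-b: joint volumes of the decoupled system

Companion (small definitions) file of `QuasiLocalGaugePerturbationDecoupling.lean` (the joint
`(U, mark)` system of a perturbation `W` on the site set `JSite = Edge d N ⊕ FarPoly` with spins
`G × Bool`). The engine built on the decoupling resamples JOINT VOLUMES: the links of a set `ΛE`
of links together with the marks of a set `ΛP` of far polymers, i.e. the finite site set
`ΛE.map linksEmb ∪ ΛP.map marksEmb`. This file fixes that bookkeeping: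

* `linksEmb` — the links as link sites; `inl_mem_union_iff`, `inr_mem_union_iff`,
  `disjoint_links_marks`, `univ_eq_links_union_marks`;
* `linkPart`, `linkPart₀` — the link variables of a joint gluing; `uOf_glueWith_union`,
  `uOf_glueWith_links` — the link field of a joint gluing is the gluing of the link variables with
  the exterior link field; `linksEquiv`; `glueWith_union_piFinsetUnion` (links first, then marks);
* `dressed ΛP` — the perturbation with the near activities and the far activities of `ΛP`
  (`total_dressed`, `total_sub_total_dressed_univ`): the `U`-marginal of the joint kernel of the
  joint volume `(ΛE, ΛP)` is the DLR kernel of `dressed ΛP` on `ΛE` (`…DecouplingMarginal`).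

## References

* H.-O. Georgii, *Gibbs Measures and Phase Transitions* (2011), Def. 1.23, Ch. 8.
* R. G. Edwards, A. D. Sokal, Phys. Rev. D 38 (1988) 2009.
-/

noncomputable section

open MeasureTheory Finset
open Literature.Probability.LatticeModels (glueWith glueWith_apply_mem glueWith_apply_not_mem
  glueWith_eq_updateFinset)

namespace Literature.MathematicalPhysics.QuantumFieldTheory

namespace QuasiLocalGaugePerturbation

variable {d N : ℕ} [NeZero N] {G : Type*} {b : ℕ}

/-! ### Link sites and joint volumes -/

variable (b) in
/-- The embedding of the links as link sites. [folklore] -/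
def linksEmb (d N : ℕ) [NeZero N] : Edge d N ↪ JSite b d N := ⟨Sum.inl, Sum.inl_injective⟩

/-- `linksEmb e = inl e`. [folklore] -/
@[simp] theorem linksEmb_apply (e : Edge d N) : linksEmb b d N e = Sum.inl e := rfl

/-- A link site belongs to the joint volume of `(ΛE, ΛP)` iff the link belongs to `ΛE`. [folklore] -/
theorem inl_mem_union_iff {ΛE : Finset (Edge d N)} {ΛP : Finset (FarPoly b d N)} {e : Edge d N} :
    Sum.inl e ∈ ΛE.map (linksEmb b d N) ∪ ΛP.map (marksEmb b d N) ↔ e ∈ ΛE := by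
  simp [Finset.mem_union, Finset.mem_map]

/-- A mark site belongs to the joint volume of `(ΛE, ΛP)` iff the far polymer belongs to `ΛP`.
[folklore] -/
theorem inr_mem_union_iff {ΛE : Finset (Edge d N)} {ΛP : Finset (FarPoly b d N)}
    {X : FarPoly b d N} :
    Sum.inr X ∈ ΛE.map (linksEmb b d N) ∪ ΛP.map (marksEmb b d N) ↔ X ∈ ΛP := by
  simp [Finset.mem_union, Finset.mem_map]

/-- The link sites and the mark sites of a joint volume are disjoint. [folklore] -/
theorem disjoint_links_marks (ΛE : Finset (Edge d N)) (ΛP : Finset (FarPoly b d N)) :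
    Disjoint (ΛE.map (linksEmb b d N)) (ΛP.map (marksEmb b d N)) := by
  rw [Finset.disjoint_left]
  rintro v hv hv'
  obtain ⟨e, -, rfl⟩ := Finset.mem_map.1 hv
  obtain ⟨X, -, hX⟩ := Finset.mem_map.1 hv'
  simp at hX

/-- Every site is a link site or a mark site. [folklore] -/
theorem univ_eq_links_union_marks :
    (Finset.univ : Finset (JSite b d N)) =
      (Finset.univ : Finset (Edge d N)).map (linksEmb b d N) ∪
        (Finset.univ : Finset (FarPoly b d N)).map (marksEmb b d N) := by
  ext v
  rcases v with e | X <;> simp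

/-! ### The link variables of a joint gluing -/

/-- The link variables of a joint gluing: the first components of the glued values on the links of
`ΛE`. [folklore] -/
def linkPart (ΛE : Finset (Edge d N)) (ΛP : Finset (FarPoly b d N))
    (u : ↥(ΛE.map (linksEmb b d N) ∪ ΛP.map (marksEmb b d N)) → G × Bool) : ↥ΛE → G :=
  fun e => (u ⟨Sum.inl e.1, inl_mem_union_iff.2 e.2⟩).1

/-- **The link field of a joint gluing** is the gluing, inside `ΛE`, of the link variables with
the link field of the exterior. [folklore] -/
theorem uOf_glueWith_union (ΛE : Finset (Edge d N)) (ΛP : Finset (FarPoly b d N))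
    (u : ↥(ΛE.map (linksEmb b d N) ∪ ΛP.map (marksEmb b d N)) → G × Bool)
    (ξ : JSite b d N → G × Bool) :
    uOf (glueWith (ΛE.map (linksEmb b d N) ∪ ΛP.map (marksEmb b d N)) u ξ) =
      glueWith ΛE (linkPart ΛE ΛP u) (uOf ξ) := by
  funext e
  by_cases he : e ∈ ΛE
  · have he' : Sum.inl e ∈ ΛE.map (linksEmb b d N) ∪ ΛP.map (marksEmb b d N) :=
      inl_mem_union_iff.2 he
    simp only [uOf]
    rw [glueWith_apply_mem _ _ _ he', glueWith_apply_mem _ _ _ he]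
    rfl
  · have he' : Sum.inl e ∉ ΛE.map (linksEmb b d N) ∪ ΛP.map (marksEmb b d N) :=
      fun h => he (inl_mem_union_iff.1 h)
    simp only [uOf]
    rw [glueWith_apply_not_mem _ _ _ he', glueWith_apply_not_mem _ _ _ he]
    rfl

/-- The link variables of a gluing of link sites only. [folklore] -/
def linkPart₀ (ΛE : Finset (Edge d N)) (y : ↥(ΛE.map (linksEmb b d N)) → G × Bool) : ↥ΛE → G :=
  fun e => (y ⟨Sum.inl e.1, Finset.mem_map_of_mem _ e.2⟩).1

/-- The link field of a gluing of link sites only. [folklore] -/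
theorem uOf_glueWith_links (ΛE : Finset (Edge d N)) (y : ↥(ΛE.map (linksEmb b d N)) → G × Bool)
    (ξ : JSite b d N → G × Bool) :
    uOf (glueWith (ΛE.map (linksEmb b d N)) y ξ) = glueWith ΛE (linkPart₀ ΛE y) (uOf ξ) := by
  funext e
  by_cases he : e ∈ ΛE
  · have he' : Sum.inl e ∈ ΛE.map (linksEmb b d N) := Finset.mem_map_of_mem _ he
    simp only [uOf]
    rw [glueWith_apply_mem _ _ _ he', glueWith_apply_mem _ _ _ he]
    rfl
  · have he' : Sum.inl e ∉ ΛE.map (linksEmb b d N) := fun h => by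
      obtain ⟨e', he'', hee⟩ := Finset.mem_map.1 h
      simp only [linksEmb_apply, Sum.inl.injEq] at hee
      exact he (hee ▸ he'')
    simp only [uOf]
    rw [glueWith_apply_not_mem _ _ _ he', glueWith_apply_not_mem _ _ _ he]
    rfl

/-- The bijection between the links of `ΛE` and their link sites. [folklore] -/
def linksEquiv (ΛE : Finset (Edge d N)) : ↥ΛE ≃ ↥(ΛE.map (linksEmb b d N)) :=
  Equiv.ofBijective (fun e => ⟨Sum.inl e.1, Finset.mem_map_of_mem _ e.2⟩)
    ⟨fun e e' h => Subtype.ext (Sum.inl_injective (congrArg Subtype.val h)), fun v => by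
      obtain ⟨e, he, hev⟩ := Finset.mem_map.1 v.2
      exact ⟨⟨e, he⟩, Subtype.ext hev⟩⟩

/-- Gluing a joint volume in two steps: links first, then marks. [folklore] -/
theorem glueWith_union_piFinsetUnion [MeasurableSpace G] (ΛE : Finset (Edge d N))
    (ΛP : Finset (FarPoly b d N))
    (hst : Disjoint (ΛE.map (linksEmb b d N)) (ΛP.map (marksEmb b d N)))
    (y : ↥(ΛE.map (linksEmb b d N)) → G × Bool) (z : ↥(ΛP.map (marksEmb b d N)) → G × Bool)
    (ξ : JSite b d N → G × Bool) :
    glueWith (ΛE.map (linksEmb b d N) ∪ ΛP.map (marksEmb b d N))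
        (MeasurableEquiv.piFinsetUnion (fun _ => G × Bool) hst (y, z)) ξ =
      glueWith (ΛP.map (marksEmb b d N)) z (glueWith (ΛE.map (linksEmb b d N)) y ξ) := by
  classical
  rw [glueWith_eq_updateFinset, glueWith_eq_updateFinset, glueWith_eq_updateFinset,
    Function.updateFinset_updateFinset hst]
  rfl

/-! ### The dressed perturbation of a set of far polymers -/

section Dressed

variable [Group G] [MeasurableSpace G] (W : QuasiLocalGaugePerturbation d N G b)

/-- The dressed perturbation of a set `ΛP` of far polymers: the near activities together with the
far activities of `ΛP`. [folklore] -/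
def dressed (ΛP : Finset (FarPoly b d N)) : QuasiLocalGaugePerturbation d N G b :=
  W.restrict fun X => X.card = 1 ∨ X ∈ ΛP.map (Function.Embedding.subtype _)

/-- The dressed perturbation is a restriction of `W`, so it inherits its norm bounds. [folklore] -/
theorem NormLE.dressed {W : QuasiLocalGaugePerturbation d N G b} {κ η : ℝ} (h : W.NormLE κ η)
    (ΛP : Finset (FarPoly b d N)) : (W.dressed ΛP).NormLE κ η :=
  h.restrict _

/-- The total of the dressed perturbation: near total plus the far activities of `ΛP`. [folklore] -/
theorem total_dressed (ΛP : Finset (FarPoly b d N)) (U : GaugeConfig d N G) :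
    (W.dressed ΛP).total U =
      (W.restrict fun X => X.card = 1).total U + ∑ X ∈ ΛP, W.act X.1 U := by
  classical
  rw [dressed, total_restrict, total_restrict, Finset.filter_or, Finset.sum_union]
  · congr 1
    have hfil : (polymers b).filter (fun X => X ∈ ΛP.map (Function.Embedding.subtype _)) =
        ΛP.map (Function.Embedding.subtype _) := by
      ext X
      simp only [Finset.mem_filter, Finset.mem_map, Function.Embedding.coe_subtype,
        and_iff_right_iff_imp]
      rintro ⟨Y, -, rfl⟩
      exact (mem_farPolymers_iff.1 Y.2).1
    rw [hfil, Finset.sum_map]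
    rfl
  · rw [Finset.disjoint_filter]
    intro X _ hX hXP
    obtain ⟨Y, -, rfl⟩ := Finset.mem_map.1 hXP
    have := (mem_farPolymers_iff.1 Y.2).2
    simp only [Function.Embedding.coe_subtype] at hX
    omega

/-- The full dressing differs from `W` only by the (constant) activity of the empty polymer.
[folklore] -/
theorem total_sub_total_dressed_univ (U U₀ : GaugeConfig d N G) :
    W.total U - (W.dressed (Finset.univ : Finset (FarPoly b d N))).total U =
      W.total U₀ - (W.dressed (Finset.univ : Finset (FarPoly b d N))).total U₀ := by
  classical
  simp only [dressed, total, restrict_act, ← Finset.sum_sub_distrib]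
  refine Finset.sum_congr rfl fun X hX => ?_
  by_cases hP : X.card = 1 ∨ X ∈ (Finset.univ : Finset (FarPoly b d N)).map
      (Function.Embedding.subtype _)
  · simp only [hP, if_true, sub_self]
  · simp only [hP, if_false, sub_zero]
    -- `X = ∅`
    push Not at hP
    have hcard : X.card = 0 := by
      by_contra h0
      have h2 : 2 ≤ X.card := by omega
      exact hP.2 (Finset.mem_map.2 ⟨⟨X, mem_farPolymers_iff.2 ⟨hX, h2⟩⟩, Finset.mem_univ _, rfl⟩)
    have hXe : X = ∅ := Finset.card_eq_zero.1 hcard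
    subst hXe
    exact W.dependsOn ∅ fun e he => by simp [polymerEdges] at he

end Dressed

end QuasiLocalGaugePerturbation

end Literature.MathematicalPhysics.QuantumFieldTheory

end
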